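import Summits.Ventures.PackingBounds.Energy.FivePointRieszThree
import Summits.Ventures.PackingBounds.Energy.ThreePointEnergyDeficit
import Summits.Ventures.PackingBounds.Energy.FivePointBipyramidRigidity
import HarnessLib

/-!
# Five points on `S²`, Riesz 3-energy: every minimiser is a triangular bipyramid (rigidity)

Framing: lottery ticket; floor = certified bounds/negative ranges. Venture `PackingBounds`, cell
`pub-packcert`, energy family E3PT (pub-packcert-energy gen 12).

Complementary slackness for the kernel-checked sharp d = 6 certificate over `ℚ(√2,√3)`
(`FivePointRieszThree.riesz_three_five_points`): if five unit vectors `C ⊂ ℝ³` attain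
`Σ_{x≠y} 1/‖x-y‖³ = 1/4 + 3√2 + (2/3)√3`, then every pair is at distance `2`, `√2` or `√3` (equality in the
Hermite minorant `1 - m³p(1-m²/2) = (2-m)(m-√2)²(m-√3)²·q(m)`, `q > 0` on `m ≥ 0`), i.e. `⟪x,y⟫ ∈ {-1, 0, -1/2}`;
`Σ x = 0` (two-point multiplier `a₁ > 0`, `ThreePointDeficit`); hence `C` is a triangular bipyramid
(`Bipyramid5.rigid`). (R. E. Schwartz, arXiv:2301.05090; here read off the exact SDP certificate.)
-/

noncomputable section

open Finset
open scoped RealInnerProductSpace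

namespace Summit.Ventures.PackingBounds.Energy.FivePointRieszThree

open Literature.Geometry.DiscreteGeometry Literature.Geometry.DiscreteGeometry.BachocVallentin
open Literature.Analysis.SpecialFunctions

/-- The Hermite cofactor is strictly positive on `m ≥ 0` (its constant coefficient is `1/12`, the others are `≥ 0` in `ℚ(√2,√3)`). -/
theorem qaux_posR3 (m : ℝ) (hm : 0 ≤ m) : 0 < qauxR3 m := by
  have q1 : (0:ℝ) ≤ (((1 : ℝ)/24) + ((1 : ℝ)/12) * s2R3 + ((1 : ℝ)/18) * s3R3 + (0 : ℝ) * (s2R3 * s3R3)) := kval_nonnegR3 _ _ _ _ (by norm_num)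
  have q2 : (0:ℝ) ≤ (((11 : ℝ)/48) + ((1 : ℝ)/24) * s2R3 + ((1 : ℝ)/36) * s3R3 + ((1 : ℝ)/18) * (s2R3 * s3R3)) := kval_nonnegR3 _ _ _ _ (by norm_num)
  have q3 : (0:ℝ) ≤ (((1 : ℝ)/48) + ((9 : ℝ)/8) * s2R3 + ((-49 : ℝ)/72) * s3R3 + ((1 : ℝ)/36) * (s2R3 * s3R3)) := kval_nonnegR3 _ _ _ _ (by norm_num)
  have q4 : (0:ℝ) ≤ (((17 : ℝ)/32) + ((15 : ℝ)/32) * s2R3 + ((-29 : ℝ)/72) * s3R3 + ((-1 : ℝ)/12) * (s2R3 * s3R3)) := kval_nonnegR3 _ _ _ _ (by norm_num)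
  have q5 : (0:ℝ) ≤ (((3 : ℝ)/16) + ((-3 : ℝ)/8) * s2R3 + ((19 : ℝ)/48) * s3R3 + ((-5 : ℝ)/48) * (s2R3 * s3R3)) := kval_nonnegR3 _ _ _ _ (by norm_num)
  have q6 : (0:ℝ) ≤ (((1 : ℝ)/32) + ((-7 : ℝ)/32) * s2R3 + ((1 : ℝ)/6) * s3R3 + (0 : ℝ) * (s2R3 * s3R3)) := kval_nonnegR3 _ _ _ _ (by norm_num)
  have hq : qauxR3 m = (((1 : ℝ)/12) + (0 : ℝ) * s2R3 + (0 : ℝ) * s3R3 + (0 : ℝ) * (s2R3 * s3R3)) + (((1 : ℝ)/24) + ((1 : ℝ)/12) * s2R3 + ((1 : ℝ)/18) * s3R3 + (0 : ℝ) * (s2R3 * s3R3)) * m + (((11 : ℝ)/48) + ((1 : ℝ)/24) * s2R3 + ((1 : ℝ)/36) * s3R3 + ((1 : ℝ)/18) * (s2R3 * s3R3)) * m ^ 2 + (((1 : ℝ)/48) + ((9 : ℝ)/8) * s2R3 + ((-49 : ℝ)/72) * s3R3 + ((1 : ℝ)/36) * (s2R3 * s3R3)) * m ^ 3 + (((17 :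 ℝ)/32) + ((15 : ℝ)/32) * s2R3 + ((-29 : ℝ)/72) * s3R3 + ((-1 : ℝ)/12) * (s2R3 * s3R3)) * m ^ 4 + (((3 : ℝ)/16) + ((-3 : ℝ)/8) * s2R3 + ((19 : ℝ)/48) * s3R3 + ((-5 : ℝ)/48) * (s2R3 * s3R3)) * m ^ 5 + (((1 : ℝ)/32) + ((-7 : ℝ)/32) * s2R3 + ((1 : ℝ)/6) * s3R3 + (0 : ℝ) * (s2R3 * s3R3)) * m ^ 6 := by unfold qauxR3; ring
  rw [hq]
  have h1 := mul_nonneg q1 hm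
  have h2 := mul_nonneg q2 (pow_nonneg hm 2)
  have h3 := mul_nonneg q3 (pow_nonneg hm 3)
  have h4 := mul_nonneg q4 (pow_nonneg hm 4)
  have h5 := mul_nonneg q5 (pow_nonneg hm 5)
  have h6 := mul_nonneg q6 (pow_nonneg hm 6)
  have h0 : (0 : ℝ) < (((1 : ℝ)/12) + (0 : ℝ) * s2R3 + (0 : ℝ) * s3R3 + (0 : ℝ) * (s2R3 * s3R3)) := by norm_num
  linarith

/-- The two-point multiplier is strictly positive (`a₁ ≈ 4.67·10⁻⁴`). -/
theorem a1_posR3 : 0 < a1KR3 := by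
  have h := kval_nonnegR3 (((46913282760528175291 : ℝ)/51721026970583040000) - 1 / 10000) (((13103281 : ℝ)/147000))
    (((-109104224 : ℝ)/1488375)) (0 : ℝ) (by norm_num)
  unfold a1KR3; linarith

/-- Equality in the Hermite minorant at distance `m ∈ (0,2]` forces `m ∈ {2, √2, √3}`. -/
theorem dist_of_pmin_eqR3 (m : ℝ) (h0 : 0 < m) (h2 : m ≤ 2) (heq : pminKR3 (1 - m ^ 2 / 2) = 1 / m ^ 3) :
    m = 2 ∨ m = s2R3 ∨ m = s3R3 := by
  have hid := one_sub_mul_pminR3 m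
  have hm1 : m ^ 3 * pminKR3 (1 - m ^ 2 / 2) = 1 := by
    rw [heq]; field_simp
  have hz : (2 - m) * (m - s2R3) ^ 2 * (m - s3R3) ^ 2 * qauxR3 m = 0 := by linarith
  have hq := qaux_posR3 m h0.le
  rcases mul_eq_zero.1 hz with h | h
  · rcases mul_eq_zero.1 h with h' | h'
    · rcases mul_eq_zero.1 h' with h'' | h''
      · left; linarith
      · right; left; exact sub_eq_zero.1 ((pow_eq_zero_iff two_ne_zero).1 h'')
    · right; right; exact sub_eq_zero.1 ((pow_eq_zero_iff two_ne_zero).1 h')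
  · exact absurd h hq.ne'

/-- For distinct unit vectors, equality in the Hermite minorant forces `⟪x,y⟫ ∈ {-1, 0, -1/2}`. -/
theorem inner_of_pmin_eqR3 {x y : EuclideanSpace ℝ (Fin 3)} (hx : ‖x‖ = 1) (hy : ‖y‖ = 1) (hxy : x ≠ y)
    (heq : pminKR3 (inner ℝ x y) = 1 / ‖x - y‖ ^ 3) :
    inner ℝ x y = -1 ∨ inner ℝ x y = 0 ∨ inner ℝ x y = -1 / 2 := by
  have hnorm : ‖x - y‖ ^ 2 = 2 - 2 * inner ℝ x y := by
    rw [@norm_sub_sq_real, hx, hy]; ring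
  have hpos : 0 < ‖x - y‖ := norm_pos_iff.2 (sub_ne_zero.2 hxy)
  have hle : ‖x - y‖ ≤ 2 := by
    calc ‖x - y‖ ≤ ‖x‖ + ‖y‖ := norm_sub_le x y
      _ = 2 := by rw [hx, hy]; norm_num
  have hin : inner ℝ x y = 1 - ‖x - y‖ ^ 2 / 2 := by linarith
  rw [hin] at heq ⊢
  have hs2 : s2R3 ^ 2 = 2 := Real.sq_sqrt (by norm_num)
  have hs3 : s3R3 ^ 2 = 3 := Real.sq_sqrt (by norm_num)
  rcases dist_of_pmin_eqR3 _ hpos hle heq with h | h | h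
  · left; rw [h]; norm_num
  · right; left; rw [h, hs2]; norm_num
  · right; right; rw [h, hs3]; norm_num

/-- **Rigidity of the Riesz 3-energy ground state of five points.** If five unit vectors of `ℝ³`
attain `Σ_{x≠y} 1/‖x-y‖³ = 1/4 + 3√2 + (2/3)√3`, then all inner products of distinct points lie in
`{-1, 0, -1/2}`, `Σ x = 0`, and the configuration is a triangular bipyramid. -/
theorem riesz_three_five_points_rigid (C : Finset (EuclideanSpace ℝ (Fin 3))) (hC : ∀ x ∈ C, ‖x‖ = 1)
    (h5 : C.card = 5)
    (hmin : ∑ x ∈ C, ∑ y ∈ C.erase x, 1 / ‖x - y‖ ^ 3 = 1 / 4 + 3 * Real.sqrt 2 + 2 / 3 * Real.sqrt 3) :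
    (∀ x ∈ C, ∀ y ∈ C, x ≠ y → inner ℝ x y = -1 ∨ inner ℝ x y = 0 ∨ inner ℝ x y = -1 / 2)
    ∧ (∑ x ∈ C, x = 0)
    ∧ ∃ p ∈ C, -p ∈ C ∧ (∀ z ∈ C, z ≠ p → z ≠ -p → inner ℝ z p = 0)
        ∧ (∀ z ∈ C, ∀ w ∈ C, z ≠ p → z ≠ -p → w ≠ p → w ≠ -p → z ≠ w → inner ℝ z w = -1 / 2) := by
  classical
  have hA := pairSum_gegenbauer_comb_nonneg (n := 3) (by norm_num) 1 acoKR3 aco_nonnegR3 C hC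
  have hF := tripleSum_threePointF3_nonneg 6 24 dcoKR3 dco_nonnegR3 gwKR3 C hC
  have hcard : (C.card : ℝ) = 5 := by exact_mod_cast h5
  have hAeval : ∀ w : ℝ, (∑ k ∈ range (1 + 1), acoKR3 k * gegenbauerSum ((((3 : ℕ) : ℝ) - 2) / 2) k w)
      = a1KR3 * w := by
    intro w
    have h0 : acoKR3 0 = 0 := rfl
    have h1 : acoKR3 1 = a1KR3 := rfl
    simp only [Finset.sum_range_succ, Finset.sum_range_zero, h0, h1, gegenbauerSum_one, gegenbauerSum_zero]
    push_cast
    ring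
  have hineq : ∀ u v t : ℝ, -1 ≤ u → u < 1 → -1 ≤ v → v < 1 → -1 ≤ t → t < 1 →
      0 ≤ 1 + 2 * u * v * t - u ^ 2 - v ^ 2 - t ^ 2 →
      c0KR3 + ((C.card : ℝ) - 2) * threePointF3 6 24 dcoKR3 gwKR3 u v t + threePointF3 6 24 dcoKR3 gwKR3 u u 1
        + threePointF3 6 24 dcoKR3 gwKR3 v v 1 + threePointF3 6 24 dcoKR3 gwKR3 t t 1
        + ((fun w => ∑ k ∈ range (1 + 1), acoKR3 k * gegenbauerSum ((((3 : ℕ) : ℝ) - 2) / 2) k w) u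
          + (fun w => ∑ k ∈ range (1 + 1), acoKR3 k * gegenbauerSum ((((3 : ℕ) : ℝ) - 2) / 2) k w) v
          + (fun w => ∑ k ∈ range (1 + 1), acoKR3 k * gegenbauerSum ((((3 : ℕ) : ℝ) - 2) / 2) k w) t) / 3
        ≤ (pminKR3 u + pminKR3 v + pminKR3 t) / 3 := by
    intro u v t hu1 hu2 hv1 hv2 ht1 ht2 hdet
    simp only [hAeval, hcard, threePointF3_eqR3]
    have h1 := slack_nonnegR3 u v t
    linarith
  have key := CohnWoo.energy_ge_of_threePoint C hC (by omega) pminKR3 _ _ c0KR3 hA hF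
    (threePointF3_swap12 6 24 dcoKR3 gwKR3) (threePointF3_swap23 6 24 dcoKR3 gwKR3) hineq
  have key' := key
  simp only [hAeval, hcard, threePointF3_eqR3] at key'
  rw [bound_eqR3] at key'
  -- pointwise minorant and termwise equality
  have hle : ∀ x ∈ C, ∀ y ∈ C.erase x, pminKR3 (inner ℝ x y) ≤ 1 / ‖x - y‖ ^ 3 := by
    intro x hx y hy
    have hyC : y ∈ C := Finset.mem_of_mem_erase hy
    have hxy : x ≠ y := fun h => (Finset.ne_of_mem_erase hy) h.symm
    have hnorm : ‖x - y‖ ^ 2 = 2 - 2 * inner ℝ x y := by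
      rw [@norm_sub_sq_real, hC x hx, hC y hyC]; ring
    have hpos : 0 < ‖x - y‖ := norm_pos_iff.2 (sub_ne_zero.2 hxy)
    have hle2 : ‖x - y‖ ≤ 2 := by
      calc ‖x - y‖ ≤ ‖x‖ + ‖y‖ := norm_sub_le x y
        _ = 2 := by rw [hC x hx, hC y hyC]; norm_num
    have hin : inner ℝ x y = 1 - ‖x - y‖ ^ 2 / 2 := by linarith
    rw [hin]
    exact pmin_leR3 _ hpos hle2
  have hs : (1 / 4 + 3 * Real.sqrt 2 + 2 / 3 * Real.sqrt 3 : ℝ) = (((1 : ℝ)/4) + (3 : ℝ) * s2R3 + ((2 : ℝ)/3) * s3R3) := rfl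
  have hsumle : ∑ x ∈ C, ∑ y ∈ C.erase x, pminKR3 (inner ℝ x y) ≤ ∑ x ∈ C, ∑ y ∈ C.erase x, 1 / ‖x - y‖ ^ 3 :=
    Finset.sum_le_sum fun x hx => Finset.sum_le_sum fun y hy => hle x hx y hy
  have hEqP : ∑ x ∈ C, ∑ y ∈ C.erase x, pminKR3 (inner ℝ x y) = (((1 : ℝ)/4) + (3 : ℝ) * s2R3 + ((2 : ℝ)/3) * s3R3) := by
    apply le_antisymm _ key'
    rw [← hs, ← hmin]; exact hsumle
  have hEq2 : ∑ x ∈ C, ∑ y ∈ C.erase x, pminKR3 (inner ℝ x y) = ∑ x ∈ C, ∑ y ∈ C.erase x, 1 / ‖x - y‖ ^ 3 := by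
    rw [hEqP, hmin, hs]
  have hterm : ∀ x ∈ C, ∀ y ∈ C.erase x, pminKR3 (inner ℝ x y) = 1 / ‖x - y‖ ^ 3 := by
    have houter := (Finset.sum_eq_sum_iff_of_le (fun x hx => Finset.sum_le_sum fun y hy => hle x hx y hy)).1 hEq2
    intro x hx
    exact (Finset.sum_eq_sum_iff_of_le (fun y hy => hle x hx y hy)).1 (houter x hx)
  have hvals : ∀ x ∈ C, ∀ y ∈ C, x ≠ y → inner ℝ x y = -1 ∨ inner ℝ x y = 0 ∨ inner ℝ x y = -1 / 2 := by
    intro x hx y hy hxy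
    have hy' : y ∈ C.erase x := Finset.mem_erase.2 ⟨fun h => hxy h.symm, hy⟩
    exact inner_of_pmin_eqR3 (hC x hx) (hC y hy) hxy (hterm x hx y hy')
  -- balanced
  have hsharp : ∑ x ∈ C, ∑ y ∈ C.erase x, pminKR3 (inner ℝ x y)
      = (C.card : ℝ) * (((C.card : ℝ) - 1) * c0KR3 - threePointF3 6 24 dcoKR3 gwKR3 1 1 1
        - (fun w => ∑ k ∈ range (1 + 1), acoKR3 k * gegenbauerSum ((((3 : ℕ) : ℝ) - 2) / 2) k w) 1) := by
    simp only [hAeval, hcard, threePointF3_eqR3]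
    rw [hEqP, ← bound_eqR3]
  obtain ⟨hA0, -⟩ := ThreePointDeficit.pairSum_eq_zero_of_sharp C hC (by omega) pminKR3 _ _ c0KR3 hA hF
    (threePointF3_swap12 6 24 dcoKR3 gwKR3) (threePointF3_swap23 6 24 dcoKR3 gwKR3) hineq hsharp
  have hfun : (fun w => ∑ k ∈ range (1 + 1), acoKR3 k * gegenbauerSum ((((3 : ℕ) : ℝ) - 2) / 2) k w)
      = fun t => a1KR3 * t := funext hAeval
  rw [hfun] at hA0
  have hsum0 : ∑ x ∈ C, x = 0 := ThreePointDeficit.sum_eq_zero_of_sharp C a1KR3 a1_posR3 hA0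
  exact ⟨hvals, hsum0, Bipyramid5.rigid C hC h5 hsum0 hvals⟩

end Summit.Ventures.PackingBounds.Energy.FivePointRieszThree
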